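import Mathlib
import Literature.Barriers.PneNP.TSPExtensionComplexityKaibelWeltge
import Literature.Barriers.PneNP.TSPExtensionComplexityHyperplaneBound
import Summits.ValiantsHypothesis.ValiantsHypothesis.Theorems.FifoMatchingNNDivisionHardLocatedRowsColumnCoupled
import Summits.ValiantsHypothesis.ValiantsHypothesis.Theorems.FifoMatchingNNDivisionHardLocatedRowsCeiling
import HarnessLib

/-!
(PART 1 of 7 of the port — part 1 — §2 the anchored star–clique tilt (`scTilt`, `sc_block`, ★★★ `exactTilted_law_on_offDiagConst`, ★★★ `exactTilted_law_holds_on_diagonal`); split for the 400-line cap; texts verbatim by name, docstrings added to helpers.)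
# SHADOW-CONSTANT READ / TWIN ROWS — decided classes of the located law of record C′ = `ExactPencilLaw`

Theorems-side port (staged by the author val-idea-41 g3; press as `Theorems/FifoMatchingNNDivisionHardShadowConstReadTilt.lean`,
`--kind proof --supports stmt-ValiantsHypothesis-21181 --as helper`) of the crux workfile `Cruxes/NNDivisionHard/ShadowConstRead41.lean`
REV 10 @72ea85f2ab68 (sha16 a021d0dfd0d83740, 1482 l., farm rc 0 / 0 sorries / 0 warnings; critic of record val-idea-crit-9 g2: WAVE-6
KEEP/KILL LIST 2026-08-29T00:50:44Z «41 g3 … `ShadowConstRead41` r1→r6 (★★★ `exactTilted_law_on_offDiagConst`, ★★★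
`exactTilted_body_of_partialCommonMax`, `offDiagConst_decided`, ★★★★ `twinBlind_decided` / `interSpan_decided` / `blocks_decided` /
`twinPCM_decided`)» KEPT; revs 7–10 (§5c–§5f) filed after the list's 00:30Z cut, graded in the wave-7 ledger).  Namespace
`Summit.ValiantsHypothesis.ValiantsHypothesis.Theorems.FifoMatching.ShadowConstRead` (parallel to `…LocatedRows`, whose frame — `T`, `RowFamily`, `three_pow_le_of_block`,
`hCOR`, `exactTilted`, `ExactPencilLaw`, `concl_of_lawBody`, `T_lt_of_block'`, `two_pow_half_mul_le` — is used BY NAME).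

CONTENT: typed DECIDED CLASSES of the located law C′ (`exactTilted.Law`) in the tree's flat socket
`HasEFOfSize (corPolytope n + convexHull ℝ (Set.range q)) r → T c n < r`: shadow-constant / diagonal passengers (anchored star–clique tilt),
partial-common-maximiser lists (junk-tolerant Kaibel–Weltge count), twin-blind / twin-PCM lists (antipodal twin rows; every span of 38 g2's
interaction matrices, so `Q_II`), and the twin transfer: a unique top — or a PCM on the top fibre — of ONE entrywise-nonnegative `S × S` pin.

HONEST LABEL: support theorems about the located LAW C′ on CLASSES of passengers, for an OPEN crux; `ExactPencilLaw` (C′), COR-VIRTUAL,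
21181 `NNDivisionHard` are OPEN.  VP ≠ VNP is NOT proved here or anywhere in this tree.
-/

set_option autoImplicit false

-- the mandated summit-side namespace repeats a component by design (single-problem summit)
set_option linter.dupNamespace false

noncomputable section

namespace Summit.ValiantsHypothesis.ValiantsHypothesis.Theorems.FifoMatching.ShadowConstRead

open Matrix Finset
open Literature.Barriers.PneNP (HasEFOfSize three_pow_le_card_mul_two_pow_of_cover_univ)
open Literature.Combinatorics.Optimization.FixedSizePsdRank (Cube bvec flat vecOuter corPolytope flat_dotProduct_vecOuter
  flat_dotProduct_le_of_mem_corPolytope)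
open Summit.ValiantsHypothesis.ValiantsHypothesis.Theorems.FifoMatching.XcDivision
  (udInd udPt udRow udMat udInd_apply udInd_sq udInd_inter ud_data udRow_dotProduct_flat_diagonal flat_dotProduct_flat)
open Summit.ValiantsHypothesis.ValiantsHypothesis.Theorems.FifoMatching.GridCorShadow (four_T_lt_two_pow)
open Summit.ValiantsHypothesis.ValiantsHypothesis.Theorems.FifoMatching.LocatedRows
  (T RowFamily three_pow_le_of_block two_pow_half_mul_le T_lt_of_block' hCOR le_hCOR exists_eq_hCOR flat_le_hCOR exactTilted ExactPencilLaw
    concl_of_lawBody CorVirtualHardN corVirtualHardN_of_exactPencilLaw sum_mul_udInd flat_dotProduct_udPt_eq)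
open scoped Pointwise

section Part1
variable {k n : ℕ}

/-! §1 THE FRAME is the tree's, BY NAME: `T`, `RowFamily`, `three_pow_le_of_block`, `hCOR`, `le_hCOR`, `exists_eq_hCOR`, `flat_le_hCOR`,
`exactTilted`, `ExactPencilLaw`, `concl_of_lawBody` (`…RowFamilies` / `…LocatedRowsColumnCoupled`), `two_pow_half_mul_le` (`…PairPencil`),
`T_lt_of_block'` (`…PinExposed`), `sum_mul_udInd` / `flat_dotProduct_udPt_eq` (`…LocatedRowsCeiling`). -/
/-! ## §2 The anchored star–clique tilt -/


/-- `⟨flat C, v⟩ = Σ_{i,m} C_{im} v_{(i,m)}` for an arbitrary vector `v ∈ ℝ^{n²}`. -/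
theorem flat_dotProduct_eq (C : Matrix (Fin n) (Fin n) ℝ) (v : Fin (n * n) → ℝ) :
    flat C ⬝ᵥ v = ∑ i, ∑ m, C i m * v (finProdFinEquiv (i, m)) := by
  unfold flat dotProduct
  rw [← finProdFinEquiv.sum_comp]
  simp only [Equiv.symm_apply_apply]
  rw [Fintype.sum_prod_type]

/-- ★ THE ANCHORED STAR–CLIQUE TILT at anchor `a₀` over the set `A`:
`scTilt a₀ A (i,m) = [i = a₀][m ∈ A] − [i ∈ A][m ∈ A] + [i = m][i ∈ A]` — the `a₀`-row indicator of `A` minus the OFF-diagonal clique of `A`. -/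
def scTilt (a₀ : Fin n) (A : Finset (Fin n)) : Matrix (Fin n) (Fin n) ℝ := fun i m =>
  udInd {a₀} i * udInd A m - (udInd A i * udInd A m - if i = m then udInd A i else 0)

/-- ★ the value formula: `⟨flat (scTilt a₀ A), x_b⟩ = |{a₀} ∩ b|·k − k² + k`, `k = |A ∩ b|`. -/
theorem scTilt_dot (a₀ : Fin n) (A b : Finset (Fin n)) :
    flat (scTilt a₀ A) ⬝ᵥ udPt b = ((({a₀} : Finset (Fin n)) ∩ b).card : ℝ) * ((A ∩ b).card : ℝ)
      - ((A ∩ b).card : ℝ) * ((A ∩ b).card : ℝ) + ((A ∩ b).card : ℝ) := by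
  rw [show udPt b = vecOuter n (udInd b) from rfl, flat_dotProduct_vecOuter]
  have e1 : ∑ i, ∑ j, (udInd {a₀} i * udInd A j) * (udInd b i * udInd b j)
      = (∑ i, udInd {a₀} i * udInd b i) * (∑ j, udInd A j * udInd b j) := by
    rw [Finset.sum_mul_sum]
    exact Finset.sum_congr rfl fun i _ => Finset.sum_congr rfl fun j _ => by ring
  have e2 : ∑ i, ∑ j, (udInd A i * udInd A j) * (udInd b i * udInd b j)
      = (∑ i, udInd A i * udInd b i) * (∑ j, udInd A j * udInd b j) := by
    rw [Finset.sum_mul_sum]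
    exact Finset.sum_congr rfl fun i _ => Finset.sum_congr rfl fun j _ => by ring
  have e3 : ∑ i, ∑ j, (if i = j then udInd A i else 0) * (udInd b i * udInd b j) = ∑ i, udInd A i * udInd b i := by
    refine Finset.sum_congr rfl fun i _ => ?_
    have : ∀ j, (if i = j then udInd A i else 0) * (udInd b i * udInd b j)
        = if i = j then udInd A i * (udInd b i * udInd b j) else 0 := fun j => by
      split_ifs <;> ring
    simp only [this, Finset.sum_ite_eq, Finset.mem_univ, if_true]
    rw [udInd_sq]
  have split : ∀ i j, scTilt a₀ A i j * (udInd b i * udInd b j)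
      = (udInd {a₀} i * udInd A j) * (udInd b i * udInd b j)
        - (udInd A i * udInd A j) * (udInd b i * udInd b j)
        + (if i = j then udInd A i else 0) * (udInd b i * udInd b j) := fun i j => by
    simp only [scTilt]; ring
  simp only [split, Finset.sum_add_distrib, Finset.sum_sub_distrib]
  rw [e1, e2, e3, udInd_inter, udInd_inter]

/-- on the face `b ∋ a₀`: `⟨scTilt, x_b⟩ = 2k − k²`. -/
theorem scTilt_dot_of_mem (a₀ : Fin n) (A : Finset (Fin n)) {b : Finset (Fin n)} (h : a₀ ∈ b) :
    flat (scTilt a₀ A) ⬝ᵥ udPt b = 2 * ((A ∩ b).card : ℝ) - ((A ∩ b).card : ℝ) * ((A ∩ b).card : ℝ) := by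
  rw [scTilt_dot, Finset.singleton_inter_of_mem h, Finset.card_singleton]
  push_cast
  ring

/-- off the face: `⟨scTilt, x_b⟩ = k − k²`. -/
theorem scTilt_dot_of_not_mem (a₀ : Fin n) (A : Finset (Fin n)) {b : Finset (Fin n)} (h : a₀ ∉ b) :
    flat (scTilt a₀ A) ⬝ᵥ udPt b = ((A ∩ b).card : ℝ) - ((A ∩ b).card : ℝ) * ((A ∩ b).card : ℝ) := by
  rw [scTilt_dot, Finset.singleton_inter_of_notMem h, Finset.card_empty]
  push_cast
  ring

/-- ★ validity with the exact value `1`: `⟨scTilt, x_b⟩ ≤ 1` on every vertex of `COR(n)`. -/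
theorem scTilt_dot_le_one (a₀ : Fin n) (A b : Finset (Fin n)) : flat (scTilt a₀ A) ⬝ᵥ udPt b ≤ 1 := by
  have hk : ((A ∩ b).card : ℝ) ≤ ((A ∩ b).card : ℝ) * ((A ∩ b).card : ℝ) := by
    exact_mod_cast Nat.le_mul_self _
  by_cases h : a₀ ∈ b
  · rw [scTilt_dot_of_mem a₀ A h]
    nlinarith [sq_nonneg (((A ∩ b).card : ℝ) - 1)]
  · rw [scTilt_dot_of_not_mem a₀ A h]
    linarith

/-- ★ `h_COR(scTilt a₀ A) = 1` as soon as `A ∌ a₀` has an element `c` (the value `1` is attained at `x_{{a₀,c}}`). -/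
theorem hCOR_scTilt (a₀ : Fin n) {A : Finset (Fin n)} (ha : a₀ ∉ A) {c : Fin n} (hc : c ∈ A) :
    hCOR (scTilt a₀ A) = 1 := by
  apply le_antisymm
  · exact Finset.sup'_le _ _ fun b _ => scTilt_dot_le_one a₀ A b
  · have h := le_hCOR (scTilt a₀ A) ({a₀, c} : Finset (Fin n))
    rw [scTilt_dot_of_mem a₀ A (by simp)] at h
    have hk : A ∩ ({a₀, c} : Finset (Fin n)) = {c} := by
      ext x
      simp only [Finset.mem_inter, Finset.mem_insert, Finset.mem_singleton]
      constructor
      · rintro ⟨hx, rfl | rfl⟩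
        · exact absurd hx ha
        · rfl
      · rintro rfl; exact ⟨hc, Or.inr rfl⟩
    rw [hk, Finset.card_singleton] at h
    norm_num at h
    exact h

/-- the support of the tilt: off-diagonal, inside `({a₀} ∪ A) × A`. -/
theorem scTilt_support (a₀ : Fin n) {A : Finset (Fin n)} (ha : a₀ ∉ A) {i m : Fin n} (h : scTilt a₀ A i m ≠ 0) :
    (i = a₀ ∨ i ∈ A) ∧ m ∈ A ∧ i ≠ m := by
  by_contra hcon
  apply h
  have e : ∀ x : Fin n, udInd ({a₀} : Finset (Fin n)) x = if x = a₀ then 1 else 0 := fun x => by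
    rw [udInd_apply]; simp
  simp only [scTilt, e, udInd_apply]
  by_cases h3 : m ∈ A
  · by_cases h4 : i = m
    · subst h4
      have hia : i ≠ a₀ := fun h' => ha (h' ▸ h3)
      simp [h3, hia]
    · have hi1 : i ≠ a₀ := fun h' => hcon ⟨Or.inl h', h3, h4⟩
      have hi2 : i ∉ A := fun h' => hcon ⟨Or.inr h', h3, h4⟩
      simp [h3, h4, hi1, hi2]
  · by_cases h4 : i = m
    · subst h4; simp [h3]
    · simp [h3, h4]

/-- ★ CONSTANT OFF-DIAGONAL SHADOW on `M`: every off-diagonal coordinate inside `M × M` of the passenger list is independent of the index. -/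
def OffDiagConst {K : ℕ} (M : Finset (Fin n)) (q : Fin (K + 1) → (Fin (n * n) → ℝ)) : Prop :=
  ∀ j j' : Fin (K + 1), ∀ i m : Fin n, i ∈ M → m ∈ M → i ≠ m →
    q j (finProdFinEquiv (i, m)) = q j' (finProdFinEquiv (i, m))

/-- every DIAGONAL passenger list has constant (zero) off-diagonal shadow on the whole of `[n]`. -/
theorem offDiagConst_of_diagonal {K : ℕ} (D : Fin (K + 1) → Fin n → ℝ) :
    OffDiagConst (Finset.univ : Finset (Fin n)) (fun j => flat (Matrix.diagonal (D j))) := by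
  intro j j' i m _ _ him
  simp [flat, Matrix.diagonal_apply_ne _ him]

/-- ★ the tilt does not see a shadow-constant passenger: `⟨flat (scTilt a₀ A), q_j⟩` is independent of `j` when `{a₀} ∪ A ⊆ M`. -/
theorem scTilt_dot_const {K : ℕ} {M : Finset (Fin n)} {q : Fin (K + 1) → (Fin (n * n) → ℝ)} (hq : OffDiagConst M q)
    (a₀ : Fin n) {A : Finset (Fin n)} (ha : a₀ ∉ A) (ha₀ : a₀ ∈ M) (hA : A ⊆ M) (j j' : Fin (K + 1)) :
    flat (scTilt a₀ A) ⬝ᵥ q j = flat (scTilt a₀ A) ⬝ᵥ q j' := by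
  rw [flat_dotProduct_eq, flat_dotProduct_eq]
  refine Finset.sum_congr rfl fun i _ => Finset.sum_congr rfl fun m _ => ?_
  by_cases h0 : scTilt a₀ A i m = 0
  · rw [h0, zero_mul, zero_mul]
  · obtain ⟨hi, hm, him⟩ := scTilt_support a₀ ha h0
    have hiM : i ∈ M := by
      rcases hi with rfl | hi
      · exact ha₀
      · exact hA hi
    rw [hq j j' i m hiM (hA hm) him]

/-- a COMMON maximising index: if the row values split as `u_j + κ_a`, any admissible row-max function is attained at one index for all rows. -/
theorem common_index {R J : Type*} (u : J → ℝ) (κ : R → ℝ) (mrow : R → ℝ) (r₀ : R)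
    (h1 : ∀ a j, u j + κ a ≤ mrow a) (h2 : ∀ a, ∃ j, u j + κ a = mrow a) :
    ∃ j₀, ∀ a, u j₀ + κ a = mrow a := by
  obtain ⟨j₀, hj₀⟩ := h2 r₀
  refine ⟨j₀, fun a => le_antisymm (h1 a j₀) ?_⟩
  obtain ⟨j, hj⟩ := h2 a
  have : u j ≤ u j₀ := by have := h1 r₀ j; linarith
  linarith

/-- the clique row of the single anchor evaluates to `1` on the face `b ∋ a₀`. -/
theorem udRow_singleton_dot (a₀ : Fin n) {b : Finset (Fin n)} (h : a₀ ∈ b) :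
    udRow ({a₀} : Finset (Fin n)) ⬝ᵥ udPt b = 1 := by
  have key := (ud_data n).2.2.1 {a₀} b
  rw [Finset.singleton_inter_of_mem h, Finset.card_singleton] at key
  norm_num at key
  linarith

/-- ★★ THE EMBEDDED BLOCK.  For a shadow-constant passenger on `M ∋ a₀, c` (`a₀ ≠ c`), ANY admissible row maxima `mrow` and ANY nonnegative
factorization of the exact-law located slack of `(COR(n), q)` through `Option (Fin r)`: `3^{|M|−2} ≤ (r+1)·2^{|M|−2}`. -/
theorem sc_block {K r : ℕ} (q : Fin (K + 1) → (Fin (n * n) → ℝ)) (M : Finset (Fin n)) (hq : OffDiagConst M q)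
    {a₀ c : Fin n} (ha₀ : a₀ ∈ M) (hc : c ∈ M) (hac : a₀ ≠ c)
    (mrow : exactTilted.A n → ℝ) (hm1 : ∀ a j, exactTilted.ρ n a ⬝ᵥ q j ≤ mrow a)
    (hm2 : ∀ a, ∃ j, exactTilted.ρ n a ⬝ᵥ q j = mrow a)
    (U : exactTilted.A n → Option (Fin r) → ℝ) (V : Finset (Fin n) × Fin (K + 1) → Option (Fin r) → ℝ)
    (hU : ∀ a i, 0 ≤ U a i) (hV : ∀ p i, 0 ≤ V p i)
    (hfac : ∀ a b j, (exactTilted.β n a + mrow a) - exactTilted.ρ n a ⬝ᵥ (udPt b + q j) = ∑ i, U a i * V (b, j) i) :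
    3 ^ (M.card - 2) ≤ (r + 1) * 2 ^ (M.card - 2) := by
  classical
  -- the free index set α = M ∖ {a₀, c}
  set α : Finset (Fin n) := (M.erase a₀).erase c with hαdef
  have hcα : c ∈ M.erase a₀ := Finset.mem_erase.mpr ⟨hac.symm, hc⟩
  have hαcard : α.card = M.card - 2 := by
    rw [hαdef, Finset.card_erase_of_mem hcα, Finset.card_erase_of_mem ha₀]
    omega
  have hαM : ∀ x ∈ α, x ∈ M ∧ x ≠ a₀ ∧ x ≠ c := fun x hx => by
    simp only [hαdef, Finset.mem_erase] at hx
    exact ⟨hx.2.2, hx.2.1, hx.1⟩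
  let emb : Finset ↥α → Finset (Fin n) := fun s => s.map (Function.Embedding.subtype _)
  have hemb : ∀ (s : Finset ↥α), ∀ x ∈ emb s, x ∈ M ∧ x ≠ a₀ ∧ x ≠ c := by
    intro s x hx
    obtain ⟨y, -, rfl⟩ := Finset.mem_map.mp hx
    exact hαM _ y.2
  -- rows and their tilt sets
  let Aset : Finset ↥α → Finset (Fin n) := fun a' => insert c (emb a')
  have hA_a₀ : ∀ a', a₀ ∉ Aset a' := fun a' h => by
    rcases Finset.mem_insert.mp h with h | h
    · exact hac h
    · exact (hemb a' a₀ h).2.1 rfl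
  have hA_c : ∀ a', c ∈ Aset a' := fun a' => Finset.mem_insert_self _ _
  have hA_M : ∀ a', Aset a' ⊆ M := fun a' x hx => by
    rcases Finset.mem_insert.mp hx with rfl | h
    · exact hc
    · exact (hemb a' x h).1
  let row : Finset ↥α → exactTilted.A n := fun a' => (({a₀} : Finset (Fin n)), scTilt a₀ (Aset a'))
  let colset : Finset ↥α → Finset (Fin n) := fun b' => insert a₀ (emb b')
  have hρ : ∀ a', exactTilted.ρ n (row a') = udRow ({a₀} : Finset (Fin n)) + flat (scTilt a₀ (Aset a')) := fun _ => rfl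
  have hβ : ∀ a', exactTilted.β n (row a') = 1 + hCOR (scTilt a₀ (Aset a')) := fun _ => rfl
  -- the passenger part splits as u_j + κ(a')
  have hsplit : ∀ a' j, exactTilted.ρ n (row a') ⬝ᵥ q j
      = udRow ({a₀} : Finset (Fin n)) ⬝ᵥ q j + flat (scTilt a₀ (Aset a')) ⬝ᵥ q 0 := by
    intro a' j
    rw [hρ, add_dotProduct, scTilt_dot_const hq a₀ (hA_a₀ a') ha₀ (hA_M a') j 0]
  obtain ⟨j₀, hj₀⟩ := common_index (fun j => udRow ({a₀} : Finset (Fin n)) ⬝ᵥ q j)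
    (fun a' => flat (scTilt a₀ (Aset a')) ⬝ᵥ q 0) (fun a' => mrow (row a')) (∅ : Finset ↥α)
    (fun a' j => by rw [← hsplit]; exact hm1 (row a') j)
    (fun a' => by obtain ⟨j, hj⟩ := hm2 (row a'); exact ⟨j, by rw [← hsplit]; exact hj⟩)
  -- intersections on the block
  have hinter : ∀ a' b' : Finset ↥α, Aset a' ∩ colset b' = emb (a' ∩ b') := by
    intro a' b'
    have hc_col : c ∉ colset b' := fun h => by
      rcases Finset.mem_insert.mp h with h | h
      · exact hac h.symm
      · exact (hemb b' c h).2.2 rfl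
    show insert c (emb a') ∩ insert a₀ (emb b') = emb (a' ∩ b')
    rw [Finset.insert_inter_of_notMem hc_col, Finset.inter_insert_of_notMem (fun h => (hemb a' a₀ h).2.1 rfl)]
    exact (Finset.map_inter _ _).symm
  -- the block identity
  have key := three_pow_le_of_block U V hU hV row (fun b' => (colset b', j₀)) (fun a' b' => ?_)
  · have h1 : Fintype.card ↥α = M.card - 2 := by rw [Fintype.card_coe, hαcard]
    have h2 : Fintype.card (Option (Fin r)) = r + 1 := by simp
    rw [h1, h2] at key
    exact key
  · rw [← hfac (row a') (colset b') j₀, dotProduct_add, hsplit a' j₀, ← hj₀ a', hβ, hCOR_scTilt a₀ (hA_a₀ a') (hA_c a'),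
      hρ, add_dotProduct, udRow_singleton_dot a₀ (Finset.mem_insert_self _ _),
      scTilt_dot_of_mem a₀ _ (Finset.mem_insert_self _ _), hinter, Finset.card_map]
    ring

/-- ★★★ **C′ = `ExactPencilLaw` HOLDS ON EVERY PASSENGER WITH CONSTANT OFF-DIAGONAL SHADOW ON A LARGE MINOR** — `exactTilted.Law` with its
passenger quantifier restricted to `OffDiagConst M q`, `n + 4 ≤ 2|M|`; literal conclusion `T c n < r`, the `HasEFOfSize` budget unused. -/
theorem exactTilted_law_on_offDiagConst : ∀ c₀ : ℕ, ∃ n₀ : ℕ, ∀ n ≥ n₀,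
    ∀ (K : ℕ) (q : Fin (K + 1) → (Fin (n * n) → ℝ)) (r : ℕ),
    (∃ M : Finset (Fin n), n + 4 ≤ 2 * M.card ∧ OffDiagConst M q) →
    HasEFOfSize (convexHull ℝ (Set.range q)) r →
    ∀ m : exactTilted.A n → ℝ, (∀ a j, exactTilted.ρ n a ⬝ᵥ q j ≤ m a) → (∀ a, ∃ j, exactTilted.ρ n a ⬝ᵥ q j = m a) →
    ∀ (U : exactTilted.A n → Option (Fin r) → ℝ) (V : Finset (Fin n) × Fin (K + 1) → Option (Fin r) → ℝ),
      (∀ a i, 0 ≤ U a i) → (∀ p i, 0 ≤ V p i) →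
      (∀ a b j, (exactTilted.β n a + m a) - exactTilted.ρ n a ⬝ᵥ (udPt b + q j) = ∑ i, U a i * V (b, j) i) →
      T c₀ n < r := by
  intro c₀
  obtain ⟨n₀, hn₀⟩ := T_lt_of_block' c₀
  refine ⟨n₀, fun n hn K q r hM _ m hm1 hm2 U V hU hV hfac => ?_⟩
  obtain ⟨M, hMcard, hq⟩ := hM
  have h2 : 1 < M.card := by omega
  obtain ⟨a₀, ha₀, c, hc, hac⟩ := Finset.one_lt_card.mp h2
  have hblock := sc_block q M hq ha₀ hc hac m hm1 hm2 U V hU hV hfac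
  exact hn₀ n hn (M.card - 2) r (by omega) hblock

/-- ★★★ **EVERY DIAGONAL PASSENGER IS DECIDED BY C′** (`Q^Π_λ` for every `λ`, every diagonal design / cube / zonotope): `exactTilted.Law`
with its passenger quantifier specialised to diagonal lists `q_j = flat (diagonal (D j))`, literal conclusion `T c n < r`. -/
theorem exactTilted_law_holds_on_diagonal : ∀ c₀ : ℕ, ∃ n₀ : ℕ, ∀ n ≥ n₀,
    ∀ (K : ℕ) (D : Fin (K + 1) → Fin n → ℝ) (r : ℕ),
    HasEFOfSize (convexHull ℝ (Set.range fun j => flat (Matrix.diagonal (D j)))) r →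
    ∀ m : exactTilted.A n → ℝ, (∀ a j, exactTilted.ρ n a ⬝ᵥ flat (Matrix.diagonal (D j)) ≤ m a) →
      (∀ a, ∃ j, exactTilted.ρ n a ⬝ᵥ flat (Matrix.diagonal (D j)) = m a) →
    ∀ (U : exactTilted.A n → Option (Fin r) → ℝ) (V : Finset (Fin n) × Fin (K + 1) → Option (Fin r) → ℝ),
      (∀ a i, 0 ≤ U a i) → (∀ p i, 0 ≤ V p i) →
      (∀ a b j, (exactTilted.β n a + m a) - exactTilted.ρ n a ⬝ᵥ (udPt b + flat (Matrix.diagonal (D j))) = ∑ i, U a i * V (b, j) i) →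
      T c₀ n < r := by
  intro c₀
  obtain ⟨n₀, hn₀⟩ := exactTilted_law_on_offDiagConst c₀
  refine ⟨max n₀ 4, fun n hn K D r hEF m hm1 hm2 U V hU hV hfac => ?_⟩
  have hn4 : 4 ≤ n := le_of_max_le_right hn
  exact hn₀ n (le_of_max_le_left hn) K (fun j => flat (Matrix.diagonal (D j))) r
    ⟨Finset.univ, by rw [Finset.card_univ, Fintype.card_fin]; omega, offDiagConst_of_diagonal D⟩ hEF m hm1 hm2 U V hU hV hfac

end Part1

end Summit.ValiantsHypothesis.ValiantsHypothesis.Theorems.FifoMatching.ShadowConstRead
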